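import Literature.NumberTheory.LFunctions.CyclicExtensionHeckeFactorisation
import Literature.NumberTheory.LFunctions.RayClassExplicitFormula
import HarnessLib

/-!
# Deuring's reduction at the level of Dirichlet coefficients: the Frobenius-twisted von Mangoldt function
# of a cyclic extension through its Hecke characters

Topic `Summits/QuantumAdvantage/QuantumAdvantage/Theorems`, cell B2b-1 (linnik-cubic), PART A (gen 12);
helper toward the crux `DegreeOnePrimesEscape` (stmt-QuantumAdvantage-11543) of route `LinnikCubicClassGroups`
— step M4 (Deuring reduction) of the Lagarias–Montgomery–Odlyzko theorem for conjugacy classes inside a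
division (LMO-PLAN).  HONEST FRAMING: the value of this file is a THEOREM (kernel-checked lemmas) — NOT
summit progress.

Let `N|E` be a finite Galois extension of number fields with cyclic group of order `n`, `χ₁` a faithful character
of `G(N|E)`, and `χ_j mod 𝔣_j` (`j < n`) ray class characters with `χ_j(𝔭) = χ₁(Frob_𝔭)^j` at the primes `𝔭`
unramified in `N` and `𝔣_j` supported on ramified primes (the data of
`Literature.NumberTheory.LFunctions.CyclicExtension.exists_primitive_heckeFactorisation`).  For `τ ∈ G(N|E)` and
`c = χ₁(τ)⁻¹`, orthogonality in the cyclic group `χ₁(G) = μ_n` gives, prime power by prime power,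

  `Σ_{j<n} c^j χ_j(𝔭^k) = n · [Frob_𝔭^k = τ]`   (`𝔭` unramified),   `|Σ_{j<n} c^j χ_j(𝔞)| ≤ n` (always),

hence for the coefficients `Λ_{χ_j}(m) = Σ_{𝔑𝔞 = m} χ_j(𝔞)Λ(𝔞)` of `−L'/L(s, χ_j)` (`rcCoef`):

  `‖Σ_{j<n} c^j Λ_{χ_j}(m) − n Λ_τ(m)‖ ≤ n Λ_ram(m)`,

`Λ_τ(m) = Σ_{𝔑𝔭^k = m, 𝔭 unramified, Frob_𝔭^k = τ} log 𝔑𝔭` the Frobenius-twisted von Mangoldt function and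
`Λ_ram(m)` the same sum over powers of RAMIFIED primes (`norm_sum_rcCoef_sub_le`); and the smoothed form
against a compactly supported weight `g` (`norm_sum_coefFordK_sub_le`).  Both weights are written as
`Σ_{𝔑𝔞 = m} w(𝔞)Λ(𝔞)` with an indicator `w` (the shape of `…WeightedPsi.lean`).
References: [LagariasMontgomeryOdlyzko1979, §3 (Deuring's reduction)]; [LagariasOdlyzko1977, §4].
-/

noncomputable section

open Finset Real Complex NumberField IsDedekindDomain UniqueFactorizationMonoid
open scoped NumberField nonZeroDivisors Classical

namespace Summit.QuantumAdvantage.QuantumAdvantage.Theorems.DegreeOnePrimesEscape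

open Literature.NumberTheory.LFunctions Literature.NumberTheory.LFunctions.NumberField
  Literature.NumberTheory.GaloisRepresentations

variable {E N : Type} [Field E] [NumberField E] [Field N] [NumberField N] [Algebra E N] [IsGalois E N]

/-! ### Prime powers of `𝓞 E` -/

/-- **Uniqueness of the prime-power representation**: `v^m = v'^k` with `m ≥ 1` forces `v = v'` and `m = k`. -/
theorem heightOneSpectrum_pow_eq_pow {v v' : HeightOneSpectrum (𝓞 E)} {m k : ℕ} (hm : 0 < m)
    (h : v.asIdeal ^ m = v'.asIdeal ^ k) : v = v' ∧ m = k := by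
  have hk : k ≠ 0 := by
    rintro rfl
    rw [pow_zero, Ideal.one_eq_top] at h
    have : v.asIdeal ^ m ≤ v.asIdeal := Ideal.pow_le_self hm.ne'
    rw [h, top_le_iff] at this
    exact v.isPrime.ne_top this
  have hle : v'.asIdeal ^ k ≤ v.asIdeal := by rw [← h]; exact Ideal.pow_le_self hm.ne'
  have hle' : v'.asIdeal ≤ v.asIdeal := (Ideal.IsPrime.pow_le_iff hk).mp hle
  have hvv' : v = v' :=
    (HeightOneSpectrum.ext (v'.isMaximal.eq_of_le v.isPrime.ne_top hle')).symm
  subst hvv'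
  exact ⟨rfl, (Ideal.pow_right_strictAnti v.asIdeal v.ne_bot v.isPrime.ne_top).injective h⟩

/-- An ideal with `Λ(𝔞) ≠ 0` is `v^m`, `m ≥ 1`, for a nonzero prime `v`, and then `Λ(𝔞) = log 𝔑v`. -/
theorem exists_eq_pow_of_idealVonMangoldt_ne_zero {I : Ideal (𝓞 E)} (hI : idealVonMangoldt I ≠ 0) :
    ∃ (v : HeightOneSpectrum (𝓞 E)) (m : ℕ), 0 < m ∧ I = v.asIdeal ^ m ∧
      idealVonMangoldt I = Real.log (Ideal.absNorm v.asIdeal) := by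
  by_cases hcard : (normalizedFactors I).toFinset.card = 1
  · obtain ⟨P, hP, -, -, hpos, hIP⟩ := eq_prime_pow_of_card_eq_one hcard
    refine ⟨⟨P, Ideal.isPrime_of_prime hP, hP.ne_zero⟩, _, hpos, hIP, ?_⟩
    rw [hIP, idealVonMangoldt_prime_pow hP hpos.ne']
  · exact absurd (idealVonMangoldt_eq_zero hcard) hI

/-! ### Orthogonality in the cyclic group `χ₁(G(N|E))` -/

omit [NumberField E] [NumberField N] [IsGalois E N] in
/-- **`Σ_{j<n} χ₁(u)^j = n·[u = 1]`** for a faithful character `χ₁` of the group `G(N|E)` of order `n`. -/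
theorem sum_pow_faithful_eq {χ₁ : (N ≃ₐ[E] N) →* ℂˣ} (hχ₁ : Function.Injective χ₁) {n : ℕ}
    (hn : Nat.card (N ≃ₐ[E] N) = n) (u : N ≃ₐ[E] N) :
    ∑ j ∈ Finset.range n, ((χ₁ u : ℂˣ) : ℂ) ^ j = if u = 1 then (n : ℂ) else 0 := by
  by_cases hu : u = 1
  · rw [if_pos hu, hu, map_one, Units.val_one]
    simp
  · rw [if_neg hu]
    have hz1 : ((χ₁ u : ℂˣ) : ℂ) ≠ 1 := by
      intro h
      apply hu
      apply hχ₁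
      rw [map_one]
      exact Units.val_eq_one.mp h
    have hzn : ((χ₁ u : ℂˣ) : ℂ) ^ n = 1 := by
      rw [← Units.val_pow_eq_pow_val, ← map_pow, ← hn, pow_card_eq_one', map_one, Units.val_one]
    rw [geom_sum_eq hz1, hzn, sub_self, zero_div]

/-! ### The character sums at one ideal -/

variable {n : ℕ} {χ₁ : (N ≃ₐ[E] N) →* ℂˣ} {𝔣 : ℕ → Ideal (𝓞 E)} {χ : ℕ → HeightOneSpectrum (𝓞 E) → ℂ}

/-- **`|Σ_{j<n} c^j χ_j(𝔞)| ≤ n`** for `|c| = 1` (each `|χ_j(𝔞)| ≤ 1`). -/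
theorem norm_sum_mul_rayClassCoeff_le (hray : ∀ j, 𝔣 j ≠ ⊥ ∧ IsRayClassCharacter (𝔣 j) (χ j))
    {c : ℂ} (hc : ‖c‖ = 1) (I : Ideal (𝓞 E)) :
    ‖∑ j ∈ Finset.range n, c ^ j * rayClassCoeffHom (𝔣 j) (χ j) I‖ ≤ n := by
  refine (norm_sum_le _ _).trans ?_
  have : ∀ j ∈ Finset.range n, ‖c ^ j * rayClassCoeffHom (𝔣 j) (χ j) I‖ ≤ 1 := fun j _ ↦ by
    rw [norm_mul, norm_pow, hc, one_pow, one_mul]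
    exact norm_rayClassCoeffHom_le (hray j).1 (fun v hv ↦ ((hray j).2.norm_eq_one v hv).le) I
  exact (Finset.sum_le_sum this).trans (by simp)

/-- The value of `χ_j` on a power of an unramified prime: `χ_j(v^k) = χ₁(Frob_v)^{jk}`. -/
theorem rayClassCoeffHom_pow_of_isUnramifiedIn (hray : ∀ j, 𝔣 j ≠ ⊥ ∧ IsRayClassCharacter (𝔣 j) (χ j))
    (hsupp : ∀ (j : ℕ) (v : HeightOneSpectrum (𝓞 E)), 𝔣 j ≤ v.asIdeal → ¬ Algebra.IsUnramifiedIn (𝓞 N) v.asIdeal)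
    (hval : ∀ (j : ℕ) (v : HeightOneSpectrum (𝓞 E)), Algebra.IsUnramifiedIn (𝓞 N) v.asIdeal →
      χ j v = ((χ₁ (galFrob E N v) : ℂˣ) : ℂ) ^ j)
    (j : ℕ) {v : HeightOneSpectrum (𝓞 E)} (hv : Algebra.IsUnramifiedIn (𝓞 N) v.asIdeal) (k : ℕ) :
    rayClassCoeffHom (𝔣 j) (χ j) (v.asIdeal ^ k) = (((χ₁ (galFrob E N v) : ℂˣ) : ℂ) ^ j) ^ k := by
  have hfv : ¬ 𝔣 j ≤ v.asIdeal := fun h ↦ hsupp j v h hv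
  have hcop : IsCoprime v.asIdeal (𝔣 j) := by
    rw [isCoprime_iff_forall_not_le (hray j).1]
    intro v' hv' hle
    have : v.asIdeal = v'.asIdeal := v.isMaximal.eq_of_le v'.isPrime.ne_top hle
    exact hfv (this ▸ hv')
  rw [map_pow, rayClassCoeffHom_apply, rayClassCoeff, if_pos ⟨v.ne_bot, hcop⟩, idealPow_asIdeal, hval j v hv]

/-- **Deuring's orthogonality at an unramified prime power**: for `v` unramified in `N`, `k : ℕ` and
`τ ∈ G(N|E)`, `Σ_{j<n} χ₁(τ)^{-j} χ_j(v^k) = n` if `Frob_v^k = τ` and `0` otherwise.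
[cite: LagariasMontgomeryOdlyzko1979, §3] -/
theorem sum_rayClassCoeffHom_pow_eq (hχ₁ : Function.Injective χ₁) (hn : Nat.card (N ≃ₐ[E] N) = n)
    (hray : ∀ j, 𝔣 j ≠ ⊥ ∧ IsRayClassCharacter (𝔣 j) (χ j))
    (hsupp : ∀ (j : ℕ) (v : HeightOneSpectrum (𝓞 E)), 𝔣 j ≤ v.asIdeal → ¬ Algebra.IsUnramifiedIn (𝓞 N) v.asIdeal)
    (hval : ∀ (j : ℕ) (v : HeightOneSpectrum (𝓞 E)), Algebra.IsUnramifiedIn (𝓞 N) v.asIdeal →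
      χ j v = ((χ₁ (galFrob E N v) : ℂˣ) : ℂ) ^ j)
    (τ : N ≃ₐ[E] N) {v : HeightOneSpectrum (𝓞 E)} (hv : Algebra.IsUnramifiedIn (𝓞 N) v.asIdeal) (k : ℕ) :
    ∑ j ∈ Finset.range n, (((χ₁ τ : ℂˣ) : ℂ)⁻¹) ^ j * rayClassCoeffHom (𝔣 j) (χ j) (v.asIdeal ^ k) =
      if galFrob E N v ^ k = τ then (n : ℂ) else 0 := by
  set u : N ≃ₐ[E] N := galFrob E N v ^ k * τ⁻¹ with hu
  have hterm : ∀ j ∈ Finset.range n,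
      (((χ₁ τ : ℂˣ) : ℂ)⁻¹) ^ j * rayClassCoeffHom (𝔣 j) (χ j) (v.asIdeal ^ k) = ((χ₁ u : ℂˣ) : ℂ) ^ j := by
    intro j _
    rw [rayClassCoeffHom_pow_of_isUnramifiedIn hray hsupp hval j hv k, hu, map_mul, map_inv, map_pow,
      Units.val_mul, Units.val_inv_eq_inv_val, Units.val_pow_eq_pow_val, ← pow_mul, mul_comm j k, pow_mul,
      ← mul_pow, mul_comm]
  rw [Finset.sum_congr rfl hterm, sum_pow_faithful_eq hχ₁ hn u]
  have hiff : u = 1 ↔ galFrob E N v ^ k = τ := by rw [hu, mul_inv_eq_one]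
  by_cases h : galFrob E N v ^ k = τ
  · rw [if_pos (hiff.mpr h), if_pos h]
  · rw [if_neg (fun h' ↦ h (hiff.mp h')), if_neg h]

/-! ### The pointwise comparison with the Frobenius-twisted von Mangoldt function -/

/-- **Pointwise Deuring reduction.**  With the indicator `w_τ` of "`𝔞 = v^k`, `v` unramified, `Frob_v^k = τ`"
and the indicator `w_ram` of "`𝔞` is a power of a ramified prime":
`‖Λ(𝔞) Σ_{j<n} χ₁(τ)^{-j} χ_j(𝔞) − n w_τ(𝔞) Λ(𝔞)‖ ≤ n w_ram(𝔞) Λ(𝔞)`. [cite: LagariasMontgomeryOdlyzko1979, §3] -/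
theorem norm_idealVonMangoldt_mul_sum_sub_le (hχ₁ : Function.Injective χ₁) (hn : Nat.card (N ≃ₐ[E] N) = n)
    (hray : ∀ j, 𝔣 j ≠ ⊥ ∧ IsRayClassCharacter (𝔣 j) (χ j))
    (hsupp : ∀ (j : ℕ) (v : HeightOneSpectrum (𝓞 E)), 𝔣 j ≤ v.asIdeal → ¬ Algebra.IsUnramifiedIn (𝓞 N) v.asIdeal)
    (hval : ∀ (j : ℕ) (v : HeightOneSpectrum (𝓞 E)), Algebra.IsUnramifiedIn (𝓞 N) v.asIdeal →
      χ j v = ((χ₁ (galFrob E N v) : ℂˣ) : ℂ) ^ j)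
    (τ : N ≃ₐ[E] N) {wτ wr : Ideal (𝓞 E) → ℝ}
    (hwτ : ∀ I, wτ I = if (∃ v : HeightOneSpectrum (𝓞 E), Algebra.IsUnramifiedIn (𝓞 N) v.asIdeal ∧
      ∃ k : ℕ, I = v.asIdeal ^ k ∧ galFrob E N v ^ k = τ) then 1 else 0)
    (hwr : ∀ I, wr I = if (∃ v : HeightOneSpectrum (𝓞 E), ¬ Algebra.IsUnramifiedIn (𝓞 N) v.asIdeal ∧
      ∃ k : ℕ, 0 < k ∧ I = v.asIdeal ^ k) then 1 else 0)
    (I : Ideal (𝓞 E)) :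
    ‖(idealVonMangoldt I : ℂ) * ∑ j ∈ Finset.range n, (((χ₁ τ : ℂˣ) : ℂ)⁻¹) ^ j * rayClassCoeffHom (𝔣 j) (χ j) I -
        (n : ℂ) * ((wτ I * idealVonMangoldt I : ℝ) : ℂ)‖ ≤ n * (wr I * idealVonMangoldt I) := by
  by_cases hΛ : idealVonMangoldt I = 0
  · rw [hΛ]; simp
  obtain ⟨v, m, hm, hIv, hΛv⟩ := exists_eq_pow_of_idealVonMangoldt_ne_zero hΛ
  have hΛ0 : 0 ≤ idealVonMangoldt I := idealVonMangoldt_nonneg I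
  by_cases hv : Algebra.IsUnramifiedIn (𝓞 N) v.asIdeal
  · -- unramified: exact identity, both sides vanish
    have hwr0 : wr I = 0 := by
      rw [hwr, if_neg]
      rintro ⟨v', hv', k, -, hk⟩
      obtain ⟨rfl, -⟩ := heightOneSpectrum_pow_eq_pow hm (hIv.symm.trans hk)
      exact hv' hv
    have hwτI : wτ I = if galFrob E N v ^ m = τ then 1 else 0 := by
      rw [hwτ]
      by_cases h : galFrob E N v ^ m = τ
      · rw [if_pos h, if_pos ⟨v, hv, m, hIv, h⟩]
      · rw [if_neg h, if_neg]
        rintro ⟨v', -, k, hk, hk'⟩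
        obtain ⟨rfl, rfl⟩ := heightOneSpectrum_pow_eq_pow hm (hIv.symm.trans hk)
        exact h hk'
    rw [hwr0, zero_mul, mul_zero, hIv, sum_rayClassCoeffHom_pow_eq hχ₁ hn hray hsupp hval τ hv m, ← hIv, hwτI]
    by_cases h : galFrob E N v ^ m = τ
    · rw [if_pos h, if_pos h]; push_cast; ring_nf; simp
    · rw [if_neg h, if_neg h]; simp
  · -- ramified: the trivial bound
    have hwr1 : wr I = 1 := by rw [hwr, if_pos ⟨v, hv, m, hm, hIv⟩]
    have hwτ0 : wτ I = 0 := by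
      rw [hwτ, if_neg]
      rintro ⟨v', hv', k, hk, -⟩
      obtain ⟨rfl, -⟩ := heightOneSpectrum_pow_eq_pow hm (hIv.symm.trans hk)
      exact hv hv'
    rw [hwr1, one_mul, hwτ0, zero_mul, Complex.ofReal_zero, mul_zero, sub_zero, norm_mul, Complex.norm_real,
      Real.norm_of_nonneg hΛ0, mul_comm]
    refine mul_le_mul_of_nonneg_right ?_ hΛ0
    have h1 : ‖((χ₁ τ : ℂˣ) : ℂ)⁻¹‖ = 1 := by
      have hfin : IsOfFinOrder τ := isOfFinOrder_of_finite τ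
      have hpow : ((χ₁ τ : ℂˣ) : ℂ) ^ orderOf τ = 1 := by
        rw [← Units.val_pow_eq_pow_val, ← map_pow, pow_orderOf_eq_one, map_one, Units.val_one]
      rw [norm_inv, Complex.norm_eq_one_of_pow_eq_one hpow hfin.orderOf_pos.ne', inv_one]
    exact norm_sum_mul_rayClassCoeff_le hray h1 I

/-- **Deuring's reduction for the coefficients `Λ_{χ_j}(m)`**:
`‖Σ_{j<n} χ₁(τ)^{-j} Λ_{χ_j}(m) − n Λ_τ(m)‖ ≤ n Λ_ram(m)`, where `Λ_{χ_j} = rcCoef (𝔣 j) (χ j)`,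
`Λ_τ(m) = Σ_{𝔑𝔞 = m} w_τ(𝔞)Λ(𝔞)` and `Λ_ram(m) = Σ_{𝔑𝔞 = m} w_ram(𝔞)Λ(𝔞)`. [cite: LagariasMontgomeryOdlyzko1979, §3] -/
theorem norm_sum_rcCoef_sub_le (hχ₁ : Function.Injective χ₁) (hn : Nat.card (N ≃ₐ[E] N) = n)
    (hray : ∀ j, 𝔣 j ≠ ⊥ ∧ IsRayClassCharacter (𝔣 j) (χ j))
    (hsupp : ∀ (j : ℕ) (v : HeightOneSpectrum (𝓞 E)), 𝔣 j ≤ v.asIdeal → ¬ Algebra.IsUnramifiedIn (𝓞 N) v.asIdeal)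
    (hval : ∀ (j : ℕ) (v : HeightOneSpectrum (𝓞 E)), Algebra.IsUnramifiedIn (𝓞 N) v.asIdeal →
      χ j v = ((χ₁ (galFrob E N v) : ℂˣ) : ℂ) ^ j)
    (τ : N ≃ₐ[E] N) {wτ wr : Ideal (𝓞 E) → ℝ}
    (hwτ : ∀ I, wτ I = if (∃ v : HeightOneSpectrum (𝓞 E), Algebra.IsUnramifiedIn (𝓞 N) v.asIdeal ∧
      ∃ k : ℕ, I = v.asIdeal ^ k ∧ galFrob E N v ^ k = τ) then 1 else 0)
    (hwr : ∀ I, wr I = if (∃ v : HeightOneSpectrum (𝓞 E), ¬ Algebra.IsUnramifiedIn (𝓞 N) v.asIdeal ∧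
      ∃ k : ℕ, 0 < k ∧ I = v.asIdeal ^ k) then 1 else 0)
    (m : ℕ) :
    ‖∑ j ∈ Finset.range n, (((χ₁ τ : ℂˣ) : ℂ)⁻¹) ^ j * rcCoef (𝔣 j) (χ j) m -
        (n : ℂ) * ((∑ I ∈ idealsOfNorm E m, wτ I * idealVonMangoldt I : ℝ) : ℂ)‖ ≤
      n * ∑ I ∈ idealsOfNorm E m, wr I * idealVonMangoldt I := by
  -- rewrite everything as a single sum over the ideals of norm `m`
  have hL : ∑ j ∈ Finset.range n, (((χ₁ τ : ℂˣ) : ℂ)⁻¹) ^ j * rcCoef (𝔣 j) (χ j) m =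
      ∑ I ∈ idealsOfNorm E m, (idealVonMangoldt I : ℂ) *
        ∑ j ∈ Finset.range n, (((χ₁ τ : ℂˣ) : ℂ)⁻¹) ^ j * rayClassCoeffHom (𝔣 j) (χ j) I := by
    simp only [rcCoef, NumberField.twistVonMangoldt, Finset.mul_sum]
    rw [Finset.sum_comm]
    refine Finset.sum_congr rfl fun I _ ↦ Finset.sum_congr rfl fun j _ ↦ by ring
  rw [hL, Complex.ofReal_sum, Finset.mul_sum, Finset.mul_sum, ← Finset.sum_sub_distrib]
  refine (norm_sum_le _ _).trans (Finset.sum_le_sum fun I _ ↦ ?_)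
  exact norm_idealVonMangoldt_mul_sum_sub_le hχ₁ hn hray hsupp hval τ hwτ hwr I

/-- **Deuring's reduction for the smoothed sums** `K_j(g) = Σ_m Λ_{χ_j}(m) g(log m)` (`coefFordK … g 0`):
for `g` vanishing on `[X, ∞)` with `|g| ≤ 1`... here only: for ANY real weight `g` vanishing on `[X,∞)`,
`‖Σ_{j<n} χ₁(τ)^{-j} K_j(g) − n ψ̃_τ(g)‖ ≤ n ψ̃_ram(|g|)`. [cite: LagariasMontgomeryOdlyzko1979, §3] -/
theorem norm_sum_coefFordK_sub_le (hχ₁ : Function.Injective χ₁) (hn : Nat.card (N ≃ₐ[E] N) = n)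
    (hray : ∀ j, 𝔣 j ≠ ⊥ ∧ IsRayClassCharacter (𝔣 j) (χ j))
    (hsupp : ∀ (j : ℕ) (v : HeightOneSpectrum (𝓞 E)), 𝔣 j ≤ v.asIdeal → ¬ Algebra.IsUnramifiedIn (𝓞 N) v.asIdeal)
    (hval : ∀ (j : ℕ) (v : HeightOneSpectrum (𝓞 E)), Algebra.IsUnramifiedIn (𝓞 N) v.asIdeal →
      χ j v = ((χ₁ (galFrob E N v) : ℂˣ) : ℂ) ^ j)
    (τ : N ≃ₐ[E] N) {wτ wr : Ideal (𝓞 E) → ℝ}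
    (hwτ : ∀ I, wτ I = if (∃ v : HeightOneSpectrum (𝓞 E), Algebra.IsUnramifiedIn (𝓞 N) v.asIdeal ∧
      ∃ k : ℕ, I = v.asIdeal ^ k ∧ galFrob E N v ^ k = τ) then 1 else 0)
    (hwr : ∀ I, wr I = if (∃ v : HeightOneSpectrum (𝓞 E), ¬ Algebra.IsUnramifiedIn (𝓞 N) v.asIdeal ∧
      ∃ k : ℕ, 0 < k ∧ I = v.asIdeal ^ k) then 1 else 0)
    {g : ℝ → ℝ} {X : ℝ} (hg : ∀ u, X ≤ u → g u = 0) :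
    ‖∑ j ∈ Finset.range n, (((χ₁ τ : ℂˣ) : ℂ)⁻¹) ^ j * coefFordK (rcCoef (𝔣 j) (χ j)) g 0 -
        (n : ℂ) * ((∑' m : ℕ, (∑ I ∈ idealsOfNorm E m, wτ I * idealVonMangoldt I) * g (Real.log m) : ℝ) : ℂ)‖ ≤
      n * ∑' m : ℕ, (∑ I ∈ idealsOfNorm E m, wr I * idealVonMangoldt I) * |g (Real.log m)| := by
  -- truncate all sums at `M = ⌈e^X⌉ + 1`
  obtain ⟨M, hM1, hMX⟩ : ∃ M : ℕ, 1 ≤ M ∧ X ≤ Real.log M := by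
    obtain ⟨M, hM⟩ := exists_nat_gt (Real.exp X)
    have hM0 : (0 : ℝ) < M := (Real.exp_pos _).trans hM
    refine ⟨M, ?_, ?_⟩
    · exact_mod_cast Nat.one_le_iff_ne_zero.2 (by rintro rfl; simp at hM0)
    · rw [Real.le_log_iff_exp_le hM0]; exact hM.le
  have hg' : ∀ m : ℕ, m ∉ Finset.range M → g (Real.log m) = 0 := by
    intro m hm
    rw [Finset.mem_range, not_lt] at hm
    exact hg _ (hMX.trans (Real.log_le_log (by exact_mod_cast hM1) (by exact_mod_cast hm)))
  have hK : ∀ j, coefFordK (rcCoef (𝔣 j) (χ j)) g 0 = ∑ m ∈ Finset.range M, rcCoef (𝔣 j) (χ j) m * (g (Real.log m) : ℂ) := by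
    intro j
    rw [coefFordK_eq_sum _ hg hM1 hMX]
    exact Finset.sum_congr rfl fun m _ ↦ by rw [neg_zero, Complex.cpow_zero, mul_one]
  have hT : (∑' m : ℕ, (∑ I ∈ idealsOfNorm E m, wτ I * idealVonMangoldt I) * g (Real.log m)) =
      ∑ m ∈ Finset.range M, (∑ I ∈ idealsOfNorm E m, wτ I * idealVonMangoldt I) * g (Real.log m) :=
    tsum_eq_sum fun m hm ↦ by rw [hg' m hm, mul_zero]
  have hR : (∑' m : ℕ, (∑ I ∈ idealsOfNorm E m, wr I * idealVonMangoldt I) * |g (Real.log m)|) =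
      ∑ m ∈ Finset.range M, (∑ I ∈ idealsOfNorm E m, wr I * idealVonMangoldt I) * |g (Real.log m)| :=
    tsum_eq_sum fun m hm ↦ by rw [hg' m hm, abs_zero, mul_zero]
  simp_rw [hK]
  rw [hT, hR, Complex.ofReal_sum, Finset.mul_sum, Finset.mul_sum]
  -- swap the sums over `j` and `m`
  have hswap : ∑ j ∈ Finset.range n, (((χ₁ τ : ℂˣ) : ℂ)⁻¹) ^ j *
      ∑ m ∈ Finset.range M, rcCoef (𝔣 j) (χ j) m * (g (Real.log m) : ℂ) =
      ∑ m ∈ Finset.range M, (∑ j ∈ Finset.range n, (((χ₁ τ : ℂˣ) : ℂ)⁻¹) ^ j * rcCoef (𝔣 j) (χ j) m) *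
        (g (Real.log m) : ℂ) := by
    simp only [Finset.mul_sum, Finset.sum_mul]
    rw [Finset.sum_comm]
    refine Finset.sum_congr rfl fun m _ ↦ Finset.sum_congr rfl fun j _ ↦ by ring
  rw [hswap, ← Finset.sum_sub_distrib]
  refine (norm_sum_le _ _).trans (Finset.sum_le_sum fun m _ ↦ ?_)
  have hpt := norm_sum_rcCoef_sub_le hχ₁ hn hray hsupp hval τ hwτ hwr m
  have e : (∑ j ∈ Finset.range n, (((χ₁ τ : ℂˣ) : ℂ)⁻¹) ^ j * rcCoef (𝔣 j) (χ j) m) * (g (Real.log m) : ℂ) -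
      (n : ℂ) * (((∑ I ∈ idealsOfNorm E m, wτ I * idealVonMangoldt I) * g (Real.log m) : ℝ) : ℂ) =
      (∑ j ∈ Finset.range n, (((χ₁ τ : ℂˣ) : ℂ)⁻¹) ^ j * rcCoef (𝔣 j) (χ j) m -
        (n : ℂ) * ((∑ I ∈ idealsOfNorm E m, wτ I * idealVonMangoldt I : ℝ) : ℂ)) * (g (Real.log m) : ℂ) := by
    push_cast; ring
  rw [e, norm_mul, Complex.norm_real, Real.norm_eq_abs, ← mul_assoc]
  exact mul_le_mul_of_nonneg_right hpt (abs_nonneg _)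

end Summit.QuantumAdvantage.QuantumAdvantage.Theorems.DegreeOnePrimesEscape
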